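import Summits.QuantumFields.YangMills.Theorems.BalabanUVNodesN19AdditiveLinksMomentBudget
import Summits.QuantumFields.YangMills.Theorems.BalabanUVNodesN19JointLawClosedFormAtScheme

/-!
# YM-DAG node N19 (= NE7 proper) — EVERY LIPSCHITZ LINK OF EVERY ADDITIVE LIPSCHITZ STATISTIC OF `d` STRINGS AT THE SCHEME (module 67's push-forward BY NAME):
# `|∫h(Σ_iφ_i(∏os_i))dgibbs_K − ∫h(Σ_iφ_i(x_i))dν| ≤ 1.2·10⁵·K·d·log₂³L∕L` whenever `R_K ≤ e^{−L}`, under the uniform `Target`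

Cell `pub-ymgap`, HUMAN RULING D-0062 (Track A) ∕ D-0149 (work-bound push), R141 (C) wider-strategy seat `pub-ymgap-dag-n19-e` (strategy
s3 = ALTERNATIVE CURRENCY), generation g33, module 17 (lineage module 164).  Route `Summits/QuantumFields/YangMills/Theses/BalabanUVNodes.lean`,
cluster item K3⁸ «SpineGivenEndpointR13SepCoPHV» (stmt-QuantumFields-27366); filed `--supports` that item `--as helper` (it proves no registered
stub).  COUNT-NEUTRAL: [bookkeeping] over the lineage BY NAME — module 67 `…N19JointLawClosedFormAtScheme` (`jointLaw_pushforward`: the step-`K`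
joint law of a finite family of strings is a law on `[−1,1]^ι` whose mixed moments are `R_K`-close to the continuum joint law's, CONDITIONAL on the
uniform `Spine.NE7.Target`) and module 163 `…N19AdditiveLinksMomentBudget` (`abs_integral_lipschitzLink_additive_sub_le_of_closeMoments`); the
scheme object appears only through module 67; nothing of Bałaban's instantiated; NOT a discharge claim.

CONTENT.  ★ `abs_integral_lipschitzLink_additive_sub_jointLaw_le`: module 157's face for a GENERAL additive Lipschitz statistic — for continuous
`1`-Lipschitz `φ_i : [−1,1] → [0,1]`, under `Spine.NE7.Target vol l₀ δ (schemeZ S os)` for EVERY string (`0 < l₀`), for a finite nonempty family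
`os : ι → List O` with a continuum joint law `ν` on `[−1,1]^ι` receiving all continuous functionals, every step `K`, every `L ≥ 2^27` with `R_K ≤ e^{−L}`
and every `K_h`-Lipschitz `h` on `ℝ`: `|∫h(Σ_iφ_i(∏os_i))dgibbs_K − ∫h(Σ_iφ_i(x_i))dν| ≤ 1.2·10⁵·K_h·d·(log₂L)³∕L` (module 163 at `r = e^{−L}` on module 67's
push-forward).  READING: along the tower, under the UNIFORM target, every Lipschitz link of every sum of Lipschitz one-string observables converges at the
ridge rate `≍ d∕L_K` up to `log³` — CURRENCY-MAP v7's composition class at the scheme (module 113 had `d∕√L_K`).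

HONEST FRAMING (binding).  [bookkeeping]; CONDITIONAL on the uniform `Target` (a hypothesis, NOT proved); TOY continuum law `ν` under hypotheses; NO
consumer in the DAG today; nothing of Bałaban's instantiated; NE7 NOT PRINTED, NOT proved; N19 NOT discharged; count-neutral.  One finite `T⁴`
programme at fixed `ε`; nothing continuum ∕ `ℝ⁴` ∕ OS ∕ mass-gap ∕ Clay.  0 `def` ∕ 0 `sorry`.
-/

noncomputable section

open Real Finset MeasureTheory Filter Topology

namespace Summit.QuantumFields.YangMills.Theorems.BalabanUVNodesN19AdditiveLinksMomentAtScheme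

open Literature.MathematicalPhysics.QuantumFieldTheory.Balaban1983to89
open T4GenFunBounds (prodObs gibbsMeasure schemeZ)
open Missing (TorusScheme)
open Summit.QuantumFields.BalabanUV.T4Continuum.Spine
open Summit.QuantumFields.YangMills.Theorems.BalabanUVNodesN19JointLawClosedFormAtScheme (jointLaw_pushforward)
open Summit.QuantumFields.YangMills.Theorems.BalabanUVNodesN19AdditiveLinksMomentBudget
  (abs_integral_lipschitzLink_additive_sub_le_of_closeMoments)

variable {ι : Type*} [Fintype ι] [Nonempty ι]
variable {φ : ι → ℝ → ℝ}
  (hφL : ∀ i, ∀ u v : ℝ, u ∈ Set.Icc (-1 : ℝ) 1 → v ∈ Set.Icc (-1 : ℝ) 1 → |φ i u - φ i v| ≤ 1 * |u - v|)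
  (hφ0 : ∀ i, ∀ u : ℝ, u ∈ Set.Icc (-1 : ℝ) 1 → 0 ≤ φ i u) (hφ1 : ∀ i, ∀ u : ℝ, u ∈ Set.Icc (-1 : ℝ) 1 → φ i u ≤ 1) (hφc : ∀ i, Continuous (φ i))
variable {G : Type*} [GaugeGroup G] [MeasurableSpace G] [RegularGaugeGroup G] [HaarData G] {O : Type*}
  (S : TorusScheme G O) (hβ : ∀ K, 0 ≤ S.β K) (hm : ∀ K o, Measurable (S.obs K o)) (h1 : ∀ K o U, |S.obs K o U| ≤ 1)
include hβ hm h1 hφL hφ0 hφ1 hφc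

/-- ★ **EVERY LIPSCHITZ LINK OF EVERY ADDITIVE LIPSCHITZ STATISTIC OF `d` STRINGS AT THE SCHEME** (continuous `1`-Lipschitz
`φ_i : [−1,1] → [0,1]`; hypotheses as in module 157): `|∫ h(Σ_iφ_i(∏os_i)) dgibbs_K − ∫ h(Σ_iφ_i(x_i)) dν| ≤ 1.2·10⁵·K_h·d·(log₂L)³∕L` whenever
`R_K ≤ e^{−L}`, `L ≥ 2^27` — module 163 on module 67's push-forward.  CONDITIONAL on the uniform `Target`; nothing of Bałaban's instantiated. [bookkeeping] -/
theorem abs_integral_lipschitzLink_additive_sub_jointLaw_le {vol l₀ : ℝ} {δ : ℕ → ℝ}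
    (hl₀ : 0 < l₀) (hT : ∀ os : List O, NE7.Target vol l₀ δ (schemeZ S os)) (os : ι → List O) (ν : Measure (ι → ℝ)) [IsProbabilityMeasure ν]
    (hν1 : ν (Set.pi Set.univ (fun _ : ι => Set.Icc (-1 : ℝ) 1))ᶜ = 0)
    (hν : ∀ f : (ι → ℝ) → ℝ, Continuous f →
      Tendsto (fun K => ∫ U, f (fun i => prodObs S K (os i) U) ∂gibbsMeasure (S.P K) (S.β K)) atTop (𝓝 (∫ x, f x ∂ν)))
    (K : ℕ) {L : ℝ} (hL : (2 : ℝ) ^ (27 : ℕ) ≤ L)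
    (hRL : 4 * Real.exp (1 + l₀) / l₀ * (∑' j, 2 * (vol * δ (K + j))) * (1 + Real.posLog (∑' j, 2 * (vol * δ (K + j)))⁻¹) ≤ Real.exp (-L))
    {h : ℝ → ℝ} {Kh : ℝ} (hK0 : 0 ≤ Kh) (hK : ∀ s s', |h s - h s'| ≤ Kh * |s - s'|) :
    |∫ U, h (∑ i, φ i (prodObs S K (os i) U)) ∂gibbsMeasure (S.P K) (S.β K) - ∫ x, h (∑ i, φ i (x i)) ∂ν| ≤
      120000 * Kh * Fintype.card ι * Real.logb 2 L ^ 3 / L := by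
  obtain ⟨P, iP, hPc, hint, -, hmom⟩ := jointLaw_pushforward S hβ hm h1 hl₀ hT os ν hν K
  have hLip : LipschitzWith (Real.toNNReal Kh) h := by
    refine LipschitzWith.of_dist_le_mul fun x y => ?_
    rw [Real.dist_eq, Real.dist_eq, Real.coe_toNNReal _ hK0]
    exact hK x y
  have hTc : Continuous fun x : ι → ℝ => ∑ i, φ i (x i) := continuous_finsetSum _ fun i _ => (hφc i).comp (continuous_apply i)
  have hc : Continuous fun x : ι → ℝ => h (∑ i, φ i (x i)) := hLip.continuous.comp hTc
  rw [← hint hc]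
  exact abs_integral_lipschitzLink_additive_sub_le_of_closeMoments hφL hφ0 hφ1 hPc hν1 hL (fun j => (hmom j).trans hRL) hφc hK0 hK

end Summit.QuantumFields.YangMills.Theorems.BalabanUVNodesN19AdditiveLinksMomentAtScheme

end
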